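/-
Soloist artefact (solo-KontsevichZagierPeriods-informed, session s26): Proposition VI-quater (a),
KERNEL part — the residual conjunct FULL^eff of KZP as a SUBOBJECT statement.  References:
A. Huber, G. Wüstholz, *Transcendence and linear relations of 1-periods*, Cambridge Tracts in
Math. 227 (2022), Prop. 7.17, Def. A.9, p. 198; A. Huber, S. Müller-Stach, *Periods and Nori
motives*, Ergebnisse 65 (2017), Rem. 9.3.5.
-/
import Mathlib

/-!
# SoloInformedSubobjectLifting — the residual conjunct of KZP as a subobject statement (s26)

Solo programme `solo-KontsevichZagierPeriods-informed`, Proposition VI-quater (a), KERNEL part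
(abstract category theory, no motives).

Context.  By Theorem IV″ and Proposition V of the programme, `KZPeriodConjecture ⟺ GPC ∧ FULL^eff`,
where `FULL^eff` says that the faithful exact functor `ι : MM^eff_Nori(ℚ,ℚ) ⥤ MM_Nori(ℚ,ℚ)`
(localisation at the Lefschetz object, [Huber–Wüstholz 2022, Def. A.9]) is full with essential image
closed under subquotients ([HW22, Prop. 7.17]; "we do not know if it is full", [HW22, p. 198]).

This file proves the purely categorical equivalence behind the reformulation
  `FULL^eff ⟺ SUB^eff := "every subobject of ι(A), A effective, is cut out by an effective mono"`.

* `SoloInformedSubobjectLifting ι` : every mono `m : S ⟶ ι.obj A` is, up to an isomorphism of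
  sources, of the form `ι.map j` for a mono `j : A' ⟶ A`  (the STRONG subobject closure).
* `soloInformed_full_of_subobjectLifting` : if `ι` preserves zero morphisms and binary biproducts
  and reflects isomorphisms, then `SoloInformedSubobjectLifting ι → ι.Full`
  (graph argument: lift the graph of `f : ι A ⟶ ι B` inside `ι (A ⊞ B)`).
* `soloInformed_subobjectLifting_of_full` : conversely, if `ι` is full and faithful and its essential
  image is closed under subobjects in the WEAK sense (sources of monos into `ι A` lie in the essential
  image), then `SoloInformedSubobjectLifting ι`.
* `soloInformed_full_iff_subobjectLifting` : the packaged equivalence under faithfulness.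

For `ι : MM^eff_Nori ⥤ MM_Nori` the hypotheses hold: `ι` is exact and faithful between abelian
categories (hence additive, preserves binary biproducts, reflects isomorphisms since abelian
categories are balanced).  No motives are formalised here; this is the logical shape only.
-/

namespace Summit.KontsevichZagierPeriods.KontsevichZagierPeriods.Theorems

open CategoryTheory CategoryTheory.Limits

universe v₁ v₂ u₁ u₂

variable {C : Type u₁} [Category.{v₁} C] {D : Type u₂} [Category.{v₂} D]

/-- STRONG subobject closure of the essential image of `ι`: every mono into `ι.obj A` is, up to an
isomorphism of its source, the image under `ι` of a mono into `A`. -/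
def SoloInformedSubobjectLifting (ι : C ⥤ D) : Prop :=
  ∀ ⦃A : C⦄ ⦃S : D⦄ (m : S ⟶ ι.obj A), Mono m →
    ∃ (A' : C) (j : A' ⟶ A) (e : ι.obj A' ≅ S), Mono j ∧ e.hom ≫ m = ι.map j

/-- WEAK subobject closure: the source of every mono into `ι.obj A` is in the essential image. -/
def SoloInformedWeakSubobjectClosure (ι : C ⥤ D) : Prop :=
  ∀ ⦃A : C⦄ ⦃S : D⦄ (m : S ⟶ ι.obj A), Mono m → ∃ A' : C, Nonempty (ι.obj A' ≅ S)

/-- Strong lifting implies weak closure (forget the mono). -/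
theorem soloInformed_weak_of_subobjectLifting (ι : C ⥤ D) (h : SoloInformedSubobjectLifting ι) :
    SoloInformedWeakSubobjectClosure ι := by
  intro A S m hm
  obtain ⟨A', _, e, _, _⟩ := h m hm
  exact ⟨A', ⟨e⟩⟩

/-- Converse direction: full + faithful + weak closure ⇒ strong lifting. -/
theorem soloInformed_subobjectLifting_of_full (ι : C ⥤ D) [ι.Full] [ι.Faithful]
    (h : SoloInformedWeakSubobjectClosure ι) : SoloInformedSubobjectLifting ι := by
  intro A S m hm
  obtain ⟨A', ⟨e⟩⟩ := h m hm
  refine ⟨A', ι.preimage (e.hom ≫ m), e, ?_, by simp⟩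
  haveI : Mono (ι.map (ι.preimage (e.hom ≫ m))) := by
    rw [ι.map_preimage]
    exact mono_comp _ _
  exact ι.mono_of_mono_map this

section graph

variable [HasZeroMorphisms C] [HasBinaryBiproducts C] [HasZeroMorphisms D]
variable (ι : C ⥤ D) [ι.PreservesZeroMorphisms] [PreservesBinaryBiproducts ι]
  [ι.ReflectsIsomorphisms]

/-- The graph argument: strong subobject lifting forces fullness. -/
theorem soloInformed_full_of_subobjectLifting (h : SoloInformedSubobjectLifting ι) : ι.Full where
  map_surjective {A B} f := by
    -- the graph of `f` as a mono into `ι (A ⊞ B)`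
    let m : ι.obj A ⟶ ι.obj (A ⊞ B) := biprod.lift (𝟙 _) f ≫ (ι.mapBiprod A B).inv
    have hlift : Mono (biprod.lift (𝟙 (ι.obj A)) f) :=
      mono_of_mono_fac (biprod.lift_fst (𝟙 (ι.obj A)) f)
    have hm : Mono m := mono_comp _ _
    obtain ⟨A', j, e, hj, he⟩ := h m hm
    -- first projection of the lifted graph is an isomorphism
    have h1 : ι.map (j ≫ biprod.fst) = e.hom := by
      rw [ι.map_comp, ← he, Category.assoc]
      change e.hom ≫ ((biprod.lift (𝟙 _) f ≫ (ι.mapBiprod A B).inv) ≫ ι.map biprod.fst) = e.hom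
      have : (ι.mapBiprod A B).inv ≫ ι.map biprod.fst = biprod.fst := by
        rw [Iso.inv_comp_eq, ι.mapBiprod_hom, biprod.lift_fst]
      rw [Category.assoc, this, biprod.lift_fst, Category.comp_id]
    haveI : IsIso (ι.map (j ≫ biprod.fst)) := by rw [h1]; infer_instance
    haveI : IsIso (j ≫ biprod.fst) := isIso_of_reflects_iso (j ≫ biprod.fst) ι
    refine ⟨inv (j ≫ biprod.fst) ≫ j ≫ biprod.snd, ?_⟩
    have h2 : ι.map (j ≫ biprod.snd) = e.hom ≫ f := by
      rw [ι.map_comp, ← he, Category.assoc]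
      change e.hom ≫ ((biprod.lift (𝟙 _) f ≫ (ι.mapBiprod A B).inv) ≫ ι.map biprod.snd) = e.hom ≫ f
      have : (ι.mapBiprod A B).inv ≫ ι.map biprod.snd = biprod.snd := by
        rw [Iso.inv_comp_eq, ι.mapBiprod_hom, biprod.lift_snd]
      rw [Category.assoc, this, biprod.lift_snd]
    rw [ι.map_comp, Functor.map_inv, IsIso.inv_comp_eq, h2, h1]

/-- Packaged: for a faithful functor preserving zero morphisms and binary biproducts and reflecting
isomorphisms, FULL ∧ (weak subobject closure) ⟺ strong subobject lifting. -/
theorem soloInformed_full_iff_subobjectLifting [ι.Faithful] :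
    (ι.Full ∧ SoloInformedWeakSubobjectClosure ι) ↔ SoloInformedSubobjectLifting ι := by
  constructor
  · rintro ⟨_, hw⟩
    exact soloInformed_subobjectLifting_of_full ι hw
  · intro h
    exact ⟨soloInformed_full_of_subobjectLifting ι h, soloInformed_weak_of_subobjectLifting ι h⟩

end graph

section abelian

/-- The hypotheses of the graph argument hold for any additive faithful functor out of a balanced
preadditive category with binary biproducts (e.g. an exact faithful functor between abelian
categories): then strong subobject lifting ⇒ full. -/
theorem soloInformed_full_of_subobjectLifting_additive
    {C : Type u₁} [Category.{v₁} C] [Preadditive C] [HasBinaryBiproducts C] [Balanced C]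
    {D : Type u₂} [Category.{v₂} D] [Preadditive D]
    (ι : C ⥤ D) [ι.Additive] [ι.Faithful] (h : SoloInformedSubobjectLifting ι) : ι.Full := by
  haveI : PreservesBinaryBiproducts ι := preservesBinaryBiproducts_of_preservesBiproducts ι
  exact soloInformed_full_of_subobjectLifting ι h

end abelian

end Summit.KontsevichZagierPeriods.KontsevichZagierPeriods.Theorems
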